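import Literature.AlgebraicGeometry.Frobenioids.PadicFrobenioidPairIsoLevelwise
import Literature.AlgebraicGeometry.Frobenioids.PadicFrobenioidPairIsoRigidity
import Literature.AlgebraicGeometry.Frobenioids.PadicFieldwiseSaturatedPrelim
import Literature.AlgebraicGeometry.Frobenioids.PadicFrobenioidFieldUnitsReconstruction
import HarnessLib

/-!
# Frobenioids II, Thm. 2.4 (ii): ORIENTATION — with "`Ψ` preserves `O^▷(−)`" the induced `ψ̄ : ℚ̄_{p₁}^× ⥲ ℚ̄_{p₂}^×` carries
# `p₁`-adic integers to `p₂`-adic integers, and in the [AbsAnab] chart it IS the units transport (`PreservesUniformizers`)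

Mochizuki, *The geometry of Frobenioids II*, Kyushu J. Math. **62** (2008) 401–460, §2, proof of Thm. 2.4, p. 20 ll. 21–27
[cite: MochizukiFrdII2008, Thm 2.4 (i) p.20]: "`Ψ` preserves «`O^▷(−)`» [cf. [Mzk5], Cor. 4.10, Cor. 4.11, (iii)]" and (ii),
p. 20 l.−5 – p. 21 l. 6 [cite: MochizukiFrdII2008, Thm 2.4 (ii) p.21]: "reconstructing the multiplicative group associated to the field
… as the groupification of the monoid `O^▷(Aᵢ)` … `Ψ` induces a pair of compatible isomorphisms `G₁ ⥲ G₂`; `K̄₁^× ⥲ K̄₂^×` … we may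
apply [[AbsAnab], Prop. 1.2.1]".

PROOF-ONLY companion (cell abc-iut, `plan/L1/SUBDAG-FrdII-Thm24.md` row W12-L17 / residual (R2) of FrdII:Thm2.4(ii); seat
abc-iut-w5-d229), sequel to `PadicFrobenioidPairIsoLevelwise` (the pair `e` levelwise) and `PadicFrobenioidPairIsoRigidity`
(the [AbsAnab] chart; `ψ̄♮ = ψ₀^{±1}`).  The one remaining bit there — uniformiser ↦ uniformiser versus its inverse — is settled by
the ORIENTATION input that print takes from [FrdI] Cor. 4.11, in the form "`Ψ_B` carries elements of `B₁(Π₁/N_k)` with EFFECTIVE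
divisor to elements with effective divisor" (`hpos`; automatic from any compatible `Ψ_Φ : Φ₁ ≅ E^op ⋙ Φ₂`):
* §1 (any `p`-adic Frobenioid datum) `PadicFrd.Datum.valuation_resK_le_one_of_divB_eq_of` — effective `Div_B(b)` ⇒ `b|_{K^×}`
  integral (sharpness of `ord(O^▷) ⊗ ℝ_{≥0}`); `exists_divB_eq_of_of_valuation_le_one` — conversely for FIELDWISE SATURATED data
  (`ord(π)` is an effective class, abc-iut-w5-d229 gen 0's `exists_phiGp_eq_generator`);
* §2 `norm_galFbar_apply` (Galois elements are isometries of `ℚ̄_p`), `valuation_le_one_iff_norm_le_one` (restricted valuation = norm);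
* §3 `exists_pairIso_fbarUnits_integral` — over the genuine §2 bases, under `hpos`: **`‖a‖ ≤ 1 ⇒ ‖ψ̄(a)‖ ≤ 1`** (orbit lemma +
  levelwise formula `ψ̄(x_{1,k}⁻¹·toB0₁ b) = x_{2,k}⁻¹·B₀(ι_k)(toB0₂(Ψ_B b))` + §1 + §2);
* §4 `exists_pairIso_absAnabChart_unitsTransport` — for ANY MLF structures on `Kᵢ = ℚ̄_{pᵢ}^{Gᵢ}` whose integers are the `pᵢ`-adic
  integers (`hvᵢ`): the chart reading `ψ̄♮` of the `Ψ`-induced pair is `α`-equivariant, `PreservesAbsUnits` AND `PreservesUniformizers`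
  — i.e. IT IS the units transport `ψ₀` of [AbsAnab] Prop. 1.2.1 (vi)/(vii) (row L02), the full Frobenioid-side input (R2) of W12's
  Thm. 2.4 (ii) closer (abc-iut-w5-d201 / L2-t12) for a GENERAL `Ψ`.  What stays named: `hpos` (print's Cor. 4.11), `hvᵢ` (classical:
  the extension of the `p`-adic valuation to `Kᵢ`), and the identification of `α` with the context isomorphism's `isoG` (abc-iut-L1-t7).
Theorems only (no definitions); nothing here bears on [IUTchIII] Cor. 3.12.
-/

noncomputable section

namespace Literature.AlgebraicGeometry.Frobenioids

open CategoryTheory CategoryTheory.Limits Opposite Topology Filter Function ValuativeRel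
open Literature.AnabelianGeometry.SemiGraphs
open scoped ValuativeRel

universe v u

/-! ### §1 Effective divisor ⟺ integral restriction to `K_A^×` (any `p`-adic Frobenioid datum) -/

namespace PadicFrd.Datum

variable {D : Type u} [Category.{v} D] {p : ℕ} [Fact p.Prime] (d : Datum D p)

/-- **Effective ⇒ integral.**  If `Div_B(b)` is an EFFECTIVE class (`= [c]`, `c ∈ Φ(A)`), then `b|_{K_A^×} ∈ O_{K_A}^⊳`
(valuation `≤ 1`): otherwise `b|_{K^×}⁻¹` is a non-unit integer and `[ι c] · ([b|⁻¹] ⊗ 1) = Div₀(b|) · Div₀(b|⁻¹) = 1`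
contradicts sharpness of `ord(O^⊳) ⊗ ℝ_{≥0}` (`eq_one_of_phiGp_mul_ordIntGp_eq_one`). [cite: MochizukiFrdII2008, Ex 1.1 (ii) p.8] -/
theorem valuation_resK_le_one_of_divB_eq_of (A : D) (b : d.B.obj (op A)) (c : d.Φ.obj (op A))
    (h : Frobenioids.divB d.Φ d.B d.divB (op A) b = Algebra.GrothendieckGroup.of c) :
    valuation (d.fld A) ((d.resK A b : (d.fld A)ˣ) : d.fld A) ≤ 1 := by
  by_contra hlt
  rw [not_le] at hlt
  set u : (d.fld A)ˣ := d.resK A b with hu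
  -- `u⁻¹` is a non-unit nonzero integer
  have hinv : valuation (d.fld A) ((u⁻¹ : (d.fld A)ˣ) : d.fld A) < 1 := by
    rw [Units.val_inv_eq_inv_val, map_inv₀]
    exact inv_lt_one_of_one_lt₀ hlt
  let x : intNonzero (d.fld A) := ⟨((u⁻¹ : (d.fld A)ˣ) : d.fld A), hinv.le, (u⁻¹).ne_zero⟩
  have hxu : intNonzeroToUnits (d.fld A) x = u⁻¹ := Units.ext rfl
  -- `[ι c] · ([u⁻¹] ⊗ 1) = Div₀(u) · Div₀(u⁻¹) = 1`
  have h1 : d.phiGp A c * d.ordIntGp A (Associates.mk x) = 1 := by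
    rw [d.ordIntGp_mk_eq_divZeroHom A x, hxu, d.phiGp_eq_monGp_map_of A c, ← h, ← d.divZeroHom_resK A b,
      ← hu, ← map_mul, mul_inv_cancel, map_one]
  have h2 := (d.eq_one_of_phiGp_mul_ordIntGp_eq_one A c _ h1).2
  rw [Associates.mk_eq_one, isUnit_intNonzero_iff] at h2
  exact (ne_of_lt hinv) h2

/-- **Integral ⇒ effective, for FIELDWISE SATURATED data.**  If `b|_{K_A^×} ∈ O_{K_A}^⊳` then `Div_B(b) = [c]` for some
`c ∈ Φ(A)`: write `[b|] = [π]^n` for a uniformiser `π` of `K_A` (`ord(O_{K_A}^⊳) ≅ ℤ_{≥0}`); fieldwise saturation gives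
`ord(π) = [ι c₀]` with `c₀ ∈ Φ(A)` EFFECTIVE (`exists_phiGp_eq_generator`), so `ι^gp Div_B(b) = Div₀(b|) = [ι c₀ⁿ]` and
`ι^gp` is injective. [cite: MochizukiFrdII2008, Thm 2.4 (i) p.20] -/
theorem exists_divB_eq_of_of_valuation_le_one (hfs : d.IsFieldwiseSaturated) (A : D) (b : d.B.obj (op A))
    (h : valuation (d.fld A) ((d.resK A b : (d.fld A)ˣ) : d.fld A) ≤ 1) :
    ∃ c : d.Φ.obj (op A), Frobenioids.divB d.Φ d.B d.divB (op A) b = Algebra.GrothendieckGroup.of c := by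
  let x : intNonzero (d.fld A) := ⟨((d.resK A b : (d.fld A)ˣ) : d.fld A), h, (d.resK A b).ne_zero⟩
  have hxu : intNonzeroToUnits (d.fld A) x = d.resK A b := Units.ext rfl
  obtain ⟨π, hπ1, hπ⟩ := d.exists_uniformizer A
  obtain ⟨n, hn⟩ := hπ (Associates.mk x)
  obtain ⟨c₀, hc₀⟩ := d.exists_phiGp_eq_generator hfs A hπ1
  refine ⟨c₀ ^ n, d.monGp_map_ιHom_injective A ?_⟩
  rw [← d.divZeroHom_resK A b, ← hxu, ← d.ordIntGp_mk_eq_divZeroHom A x, hn, map_pow, ← hc₀, ← map_pow,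
    d.phiGp_eq_monGp_map_of A]

end PadicFrd.Datum

/-! ### §2 At the genuine base: valuation = norm in `ℚ̄_p`, and Galois elements are isometries -/

namespace BaseGaloisSystem

open QuasiTemperoid

section Norms

variable (p : ℕ) [Fact p.Prime]

/-- `G_{ℚ_p}` acts on `ℚ̄_p` by ISOMETRIES (the norm of `ℚ̄_p` is the spectral norm, Mathlib `spectralNorm_eq_of_equiv`).
[cite: MochizukiFrdII2008, Ex 1.1 (i) p.7] -/
theorem norm_galFbar_apply (g : GalFbar ℚ_[p]) (a : Fbar ℚ_[p]) :
    ‖(show PadicAlgCl p from g a)‖ = ‖(show PadicAlgCl p from a)‖ := by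
  change ‖(g (a : PadicAlgCl p) : PadicAlgCl p)‖ = ‖(a : PadicAlgCl p)‖
  rw [← PadicAlgCl.spectralNorm_eq, ← PadicAlgCl.spectralNorm_eq, ← spectralNorm_eq_of_equiv]

/-- For `K ⊆ ℚ̄_p` with the restricted `p`-adic valuation (`subfieldValuativeRel`): `v(a) ≤ 1 ↔ ‖a‖ ≤ 1` in `ℚ̄_p`.
[cite: MochizukiFrdII2008, Ex 1.1 (i) p.7] -/
theorem valuation_le_one_iff_norm_le_one (K : IntermediateField ℚ_[p] (Fbar ℚ_[p])) (a : K) :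
    letI := subfieldValuativeRel p K
    valuation K a ≤ 1 ↔ ‖(a : PadicAlgCl p)‖ ≤ 1 := by
  letI := subfieldValuativeRel p K
  rw [← map_one (valuation K), ← Valuation.vle_iff_le, subfield_vle_iff]
  change _ ≤ ‖((1 : K) : PadicAlgCl p)‖ ↔ _
  rw [OneMemClass.coe_one, norm_one]

end Norms

/-! ### §3 Under "`Ψ` preserves `O^▷`": `ψ̄` carries `p₁`-adic integers of `ℚ̄_{p₁}` to `p₂`-adic integers of `ℚ̄_{p₂}` -/

section Orientation

variable {p₁ p₂ : ℕ} [Fact p₁.Prime] [Fact p₂.Prime]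
  {G : Type} [Group G] [TopologicalSpace G] [IsTopologicalGroup G] (hG : IsTempered G)
  {G₂ : Type} [Group G₂] [TopologicalSpace G₂] [IsTopologicalGroup G₂] (hG₂ : IsTempered G₂)
  (φ₁ : G →* GalFbar ℚ_[p₁]) (hφ₁ : IsOpenHom φ₁) (φ₂ : G₂ →* GalFbar ℚ_[p₂]) (hφ₂ : IsOpenHom φ₂)
  (N : ℕ → OpenNormalSubgroup G) (hN : Antitone N)
  (d₁ : PadicFrd.Datum (CosetCat G) p₁) (d₂ : PadicFrd.Datum (CosetCat G₂) p₂)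

include hG hG₂ hN in
/-- **[FrdII] Thm. 2.4 (ii) with the orientation input of [FrdI] Cor. 4.11 ("`Ψ` preserves `O^▷(−)`").**  For fieldwise
saturated `pᵢ`-adic Frobenioid data over the genuine §2 bases, `E = Ψ^Base` with the row-L02 slot `Ψ_B : B₁ ≅ E^op ⋙ B₂`, a
cofinal tower for `Π₁`, AND the hypothesis that `Ψ_B` carries elements of `B₁(Π₁/N_k)` with EFFECTIVE divisor to elements with
effective divisor (which any compatible `Ψ_Φ : Φ₁ ≅ E^op ⋙ Φ₂` supplies — print: [FrdI] Cor. 4.11 (ii)(iii), "`Ψ` preserves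
`O^▷(−)`"): the compatible pair (`φ : Π₁ ≃ₜ* Π₂` over `ψ : G₁ ≃ₜ* G₂`, `ψ̄ : ℚ̄_{p₁}^× ⥲ ℚ̄_{p₂}^×` with `ψ̄(σ·a) = ψ(σ)·ψ̄(a)`)
has `ψ̄` carrying `p₁`-ADIC INTEGERS to `p₂`-ADIC INTEGERS: `‖a‖ ≤ 1 ⇒ ‖ψ̄(a)‖ ≤ 1`.  Proof: every integral `a ∈ ℚ̄_{p₁}` is
`x_{1,k}⁻¹ · toB0₁(b)` for `k ≫ 0` (orbit lemma) with `b|_{K^×}` integral, hence `Div_B(b)` effective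
(`exists_divB_eq_of_of_valuation_le_one`), hence `Div_B(Ψ_B b)` effective, hence `toB0₂(Ψ_B b)` integral
(`valuation_resK_le_one_of_divB_eq_of`), and `ψ̄(a) = x_{2,k}⁻¹ · B₀(ι_k)(toB0₂(Ψ_B b))` by the levelwise formula
(`exists_pairIso_fbarUnits_levelwise`), Galois elements being isometries. [cite: MochizukiFrdII2008, Thm 2.4 (ii) p.21] -/
theorem exists_pairIso_fbarUnits_integral
    (hd₁ : d₁.base = CosetCat.push φ₁ hφ₁.isOpenMap ⋙ CosetCat.toConnected (isTempered_galFbar ℚ_[p₁]) ⋙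
      galoisPadicFields p₁)
    (hd₂ : d₂.base = CosetCat.push φ₂ hφ₂.isOpenMap ⋙ CosetCat.toConnected (isTempered_galFbar ℚ_[p₂]) ⋙
      galoisPadicFields p₂)
    (hfs₁ : d₁.IsFieldwiseSaturated) (hfs₂ : d₂.IsFieldwiseSaturated)
    (E : CosetCat G ≌ CosetCat G₂) (ΨB : d₁.B ≅ E.functor.op ⋙ d₂.B)
    (hNb : ∀ U ∈ 𝓝 (1 : G), ∃ k, (N k : Set G) ⊆ U)
    (hpos : ∀ (k : ℕ) (b : d₁.B.obj (op (cQ (N k)))) (c : d₁.Φ.obj (op (cQ (N k)))),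
      Frobenioids.divB d₁.Φ d₁.B d₁.divB (op (cQ (N k))) b = Algebra.GrothendieckGroup.of c →
      ∃ c₂ : d₂.Φ.obj (op (E.functor.obj (cQ (N k)))),
        Frobenioids.divB d₂.Φ d₂.B d₂.divB (op (E.functor.obj (cQ (N k)))) (ΨB.hom.app (op (cQ (N k))) b) =
          Algebra.GrothendieckGroup.of c₂) :
    ∃ (φ : G ≃ₜ* G₂) (ψ : φ₁.range ≃ₜ* φ₂.range) (ψbar : (Fbar ℚ_[p₁])ˣ ≃* (Fbar ℚ_[p₂])ˣ),
      φ₁.ker.map φ.toMulEquiv.toMonoidHom = φ₂.ker ∧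
      (∀ g : G, (ψ ⟨φ₁ g, ⟨g, rfl⟩⟩ : GalFbar ℚ_[p₂]) = φ₂ (φ g)) ∧
      (∀ (σ : φ₁.range) (u : (Fbar ℚ_[p₁])ˣ),
        ψbar (Units.map ((σ : GalFbar ℚ_[p₁]) : Fbar ℚ_[p₁] →* Fbar ℚ_[p₁]) u) =
          Units.map (((ψ σ : φ₂.range) : GalFbar ℚ_[p₂]) : Fbar ℚ_[p₂] →* Fbar ℚ_[p₂]) (ψbar u)) ∧
      ∀ u : (Fbar ℚ_[p₁])ˣ, ‖(show PadicAlgCl p₁ from (u : Fbar ℚ_[p₁]))‖ ≤ 1 →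
        ‖(show PadicAlgCl p₂ from ((ψbar u : (Fbar ℚ_[p₂])ˣ) : Fbar ℚ_[p₂]))‖ ≤ 1 := by
  haveI := hasColimitsOfShape_nat_commMonCat.{0}
  obtain ⟨base₁, hloc₁, hc₁, he₁, Φ₁, j₁, hj₁, hmono₁, B₁, toB0₁, divB₁, sq₁, cart₁, nz₁⟩ := d₁
  obtain ⟨base₂, hloc₂, hc₂, he₂, Φ₂, j₂, hj₂, hmono₂, B₂, toB0₂, divB₂, sq₂, cart₂, nz₂⟩ := d₂
  cases hd₁
  cases hd₂
  -- abbreviate the two (literal) data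
  let d₁ : PadicFrd.Datum (CosetCat G) p₁ := ⟨CosetCat.push φ₁ hφ₁.isOpenMap ⋙
    CosetCat.toConnected (isTempered_galFbar ℚ_[p₁]) ⋙ galoisPadicFields p₁, hloc₁, hc₁, he₁, Φ₁, j₁, hj₁, hmono₁, B₁,
    toB0₁, divB₁, sq₁, cart₁, nz₁⟩
  let d₂ : PadicFrd.Datum (CosetCat G₂) p₂ := ⟨CosetCat.push φ₂ hφ₂.isOpenMap ⋙
    CosetCat.toConnected (isTempered_galFbar ℚ_[p₂]) ⋙ galoisPadicFields p₂, hloc₂, hc₂, he₂, Φ₂, j₂, hj₂, hmono₂, B₂,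
    toB0₂, divB₂, sq₂, cart₂, nz₂⟩
  obtain ⟨x₁, hx₁⟩ := exists_rep_basePt_seq φ₁ hφ₁ N
  obtain ⟨φ, ψ, N₂, hN₂, hN₂b, hlev, ι, e, x₂, hx₂, ι₁, ι₂, ψbar, hker, hψ, he, hlw, hleg₁, hleg₂, hfac, hψbar, hσ⟩ :=
    exists_pairIso_fbarUnits_levelwise hG hG₂ φ₁ hφ₁ φ₂ hφ₂ N hN d₁ d₂ rfl rfl hfs₁ hfs₂ E ΨB hNb x₁ hx₁
  refine ⟨φ, ψ, ψbar, hker, hψ, hσ, fun u hu => ?_⟩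
  -- (1) `a = u` lies, with its orbit, in `K_{1,k}` for `k ≫ 0`; `w := x_{1,k}·a ∈ K_{1,k}`, integral
  obtain ⟨k, hk⟩ := exists_orbit_mem_fixFld_genuine φ₁ hφ₁ N hNb (u : Fbar ℚ_[p₁])
  let K₁ : IntermediateField ℚ_[p₁] (Fbar ℚ_[p₁]) :=
    fixFld ℚ_[p₁] ((CosetCat.toConnected (isTempered_galFbar ℚ_[p₁])).obj ((CosetCat.push φ₁ hφ₁.isOpenMap).obj (cQ (N k))))
  have hw0 : (⟨x₁ k (u : Fbar ℚ_[p₁]), hk (x₁ k)⟩ : K₁) ≠ 0 := fun h =>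
    u.ne_zero ((map_eq_zero_iff _ (x₁ k).injective).mp (congrArg Subtype.val h))
  let W : K₁ˣ := Units.mk0 _ hw0
  have hWval : ((W : K₁) : Fbar ℚ_[p₁]) = x₁ k (u : Fbar ℚ_[p₁]) := rfl
  have hWint : letI := subfieldValuativeRel p₁ K₁; valuation K₁ (W : K₁) ≤ 1 := by
    refine (valuation_le_one_iff_norm_le_one p₁ K₁ (W : K₁)).mpr ?_
    rw [hWval]
    exact (norm_galFbar_apply p₁ (x₁ k) (u : Fbar ℚ_[p₁])).le.trans hu
  -- (2) `W = toB0₁ b`, `Div_B(b)` effective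
  obtain ⟨b, hb⟩ := d₁.toB0_surjective_of_isFieldwiseSaturated hfs₁ (op (cQ (N k))) W
  have hres : d₁.resK (cQ (N k)) b = W := hb
  obtain ⟨c, hc⟩ := d₁.exists_divB_eq_of_of_valuation_le_one hfs₁ (cQ (N k)) b (by rw [hres]; exact hWint)
  -- (3) `Div_B(Ψ_B b)` effective, so `toB0₂ (Ψ_B b)` integral
  obtain ⟨c₂, hc₂⟩ := hpos k b c hc
  have hint₂ := d₂.valuation_resK_le_one_of_divB_eq_of (E.functor.obj (cQ (N k))) (ΨB.hom.app (op (cQ (N k))) b) c₂ hc₂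
  let K₂E : IntermediateField ℚ_[p₂] (Fbar ℚ_[p₂]) :=
    fixFld ℚ_[p₂] ((CosetCat.toConnected (isTempered_galFbar ℚ_[p₂])).obj
      ((CosetCat.push φ₂ hφ₂.isOpenMap).obj (E.functor.obj (cQ (N k)))))
  have hnorm₂ : ‖(((show K₂Eˣ from d₂.resK (E.functor.obj (cQ (N k))) (ΨB.hom.app (op (cQ (N k))) b)) : K₂E) :
      PadicAlgCl p₂)‖ ≤ 1 :=
    (valuation_le_one_iff_norm_le_one p₂ K₂E _).mp hint₂
  -- (4) the field map of `ι_k` is a Galois element, an isometry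
  let K₂ : IntermediateField ℚ_[p₂] (Fbar ℚ_[p₂]) :=
    fixFld ℚ_[p₂] ((CosetCat.toConnected (isTempered_galFbar ℚ_[p₂])).obj ((CosetCat.push φ₂ hφ₂.isOpenMap).obj (cQ (N₂ k))))
  let z : K₂ˣ := (PadicFrd.bZeroOn d₂.base).map (ι.hom.app k)
    (d₂.toB0.app (op (E.functor.obj (cQ (N k)))) (ΨB.hom.app (op (cQ (N k))) b))
  have hzval : ((z : K₂) : Fbar ℚ_[p₂]) =
      carrier ((CosetCat.toConnected (isTempered_galFbar ℚ_[p₂])).map ((CosetCat.push φ₂ hφ₂.isOpenMap).map (ι.hom.app k).unop))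
        (((show K₂Eˣ from d₂.resK (E.functor.obj (cQ (N k))) (ΨB.hom.app (op (cQ (N k))) b)) : K₂E) : Fbar ℚ_[p₂]) :=
    fieldMap_apply_of_ρ_eq _ (carrier_spec _) _
  have hznorm : ‖((z : K₂) : PadicAlgCl p₂)‖ ≤ 1 := by
    change ‖(show PadicAlgCl p₂ from ((z : K₂) : Fbar ℚ_[p₂]))‖ ≤ 1
    rw [hzval, norm_galFbar_apply]
    exact hnorm₂
  -- (5) `u = ι₁ [W]_k`, so `ψ̄ u = ι₂ (e [toB0₁ b]_k) = ι₂ [z]_k` has value `x_{2,k}⁻¹ · z`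
  have huW : u = ι₁.hom (colimit.ι (cosetSystem N hN ⋙ PadicFrd.bZeroOn d₁.base) k W) := by
    apply Units.ext
    rw [hleg₁ k W]
    change (u : Fbar ℚ_[p₁]) = (x₁ k)⁻¹ (x₁ k (u : Fbar ℚ_[p₁]))
    rw [← AlgEquiv.mul_apply, inv_mul_cancel, AlgEquiv.one_apply]
  have hψu : ((ψbar u : (Fbar ℚ_[p₂])ˣ) : Fbar ℚ_[p₂]) = (x₂ k)⁻¹ ((z : K₂) : Fbar ℚ_[p₂]) := by
    rw [huW, ← hb, hfac, hlw k b, hleg₂ k]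
    rfl
  change ‖(show PadicAlgCl p₂ from ((ψbar u : (Fbar ℚ_[p₂])ˣ) : Fbar ℚ_[p₂]))‖ ≤ 1
  rw [hψu, norm_galFbar_apply]
  exact hznorm

end Orientation

/-! ### §4 In the [AbsAnab] chart: `ψ̄♮` IS the units transport `ψ₀` — `PreservesUniformizers` for a general `Ψ` -/

section Chart

open Literature.AnabelianGeometry.AbsoluteAnabelian Field

variable {p₁ p₂ : ℕ} [Fact p₁.Prime] [Fact p₂.Prime]
  {G : Type} [Group G] [TopologicalSpace G] [IsTopologicalGroup G] (hG : IsTempered G)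
  {G₂ : Type} [Group G₂] [TopologicalSpace G₂] [IsTopologicalGroup G₂] (hG₂ : IsTempered G₂)
  (φ₁ : G →* GalFbar ℚ_[p₁]) (hφ₁ : IsOpenHom φ₁) (φ₂ : G₂ →* GalFbar ℚ_[p₂]) (hφ₂ : IsOpenHom φ₂)
  (N : ℕ → OpenNormalSubgroup G) (hN : Antitone N)
  (d₁ : PadicFrd.Datum (CosetCat G) p₁) (d₂ : PadicFrd.Datum (CosetCat G₂) p₂)

include hG hG₂ hN in
/-- **[FrdII] Thm. 2.4 (ii) for a GENERAL equivalence `Ψ`: the full (R2) triple.**  In the setting of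
`exists_pairIso_fbarUnits_integral` ("`Ψ` preserves `O^▷`"), and for ANY MLF structures on the base fields
`Kᵢ = ℚ̄_{pᵢ}^{Gᵢ}` whose integers are the `pᵢ`-adic integers of `ℚ̄_{pᵢ}` lying in `Kᵢ` (`hv₁`, `hv₂` — e.g. the restriction of the
`p`-adic valuation), the chart reading (`α : Gal(K̄₁/K₁) ≃ₜ* Gal(K̄₂/K₂)`, `ψ̄♮ : K̄₁^× ⥲ K̄₂^×`) of the pair induced by `Ψ` IS the
units transport of [AbsAnab] Prop. 1.2.1: `ψ̄♮` is `α`-equivariant, carries `𝒪^×_{K̄₁}` onto `𝒪^×_{K̄₂}`, AND carries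
uniformisers of `K₁` to uniformisers of `K₂` — the inversion alternative of `IsAlphaEquivariant.eq_or_eq_inv` would send a
uniformiser `π₁` to the inverse of a uniformiser, which is not a `p₂`-adic integer, contradicting
`exists_pairIso_fbarUnits_integral`. [cite: MochizukiFrdII2008, Thm 2.4 (ii) p.21] -/
theorem exists_pairIso_absAnabChart_unitsTransport
    [ValuativeRel (PadicFrd.RelGal.baseFld p₁ φ₁ hφ₁)] [TopologicalSpace (PadicFrd.RelGal.baseFld p₁ φ₁ hφ₁)]
    [IsNonarchimedeanLocalField (PadicFrd.RelGal.baseFld p₁ φ₁ hφ₁)]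
    [ValuativeRel (PadicFrd.RelGal.baseFld p₂ φ₂ hφ₂)] [TopologicalSpace (PadicFrd.RelGal.baseFld p₂ φ₂ hφ₂)]
    [IsNonarchimedeanLocalField (PadicFrd.RelGal.baseFld p₂ φ₂ hφ₂)]
    (hv₁ : ∀ x : PadicFrd.RelGal.baseFld p₁ φ₁ hφ₁,
      valuation (PadicFrd.RelGal.baseFld p₁ φ₁ hφ₁) x ≤ 1 ↔ ‖((x : Fbar ℚ_[p₁]) : PadicAlgCl p₁)‖ ≤ 1)
    (hv₂ : ∀ x : PadicFrd.RelGal.baseFld p₂ φ₂ hφ₂,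
      valuation (PadicFrd.RelGal.baseFld p₂ φ₂ hφ₂) x ≤ 1 ↔ ‖((x : Fbar ℚ_[p₂]) : PadicAlgCl p₂)‖ ≤ 1)
    (hd₁ : d₁.base = CosetCat.push φ₁ hφ₁.isOpenMap ⋙ CosetCat.toConnected (isTempered_galFbar ℚ_[p₁]) ⋙
      galoisPadicFields p₁)
    (hd₂ : d₂.base = CosetCat.push φ₂ hφ₂.isOpenMap ⋙ CosetCat.toConnected (isTempered_galFbar ℚ_[p₂]) ⋙
      galoisPadicFields p₂)
    (hfs₁ : d₁.IsFieldwiseSaturated) (hfs₂ : d₂.IsFieldwiseSaturated)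
    (E : CosetCat G ≌ CosetCat G₂) (ΨB : d₁.B ≅ E.functor.op ⋙ d₂.B)
    (hNb : ∀ U ∈ 𝓝 (1 : G), ∃ k, (N k : Set G) ⊆ U)
    (hpos : ∀ (k : ℕ) (b : d₁.B.obj (op (cQ (N k)))) (c : d₁.Φ.obj (op (cQ (N k)))),
      Frobenioids.divB d₁.Φ d₁.B d₁.divB (op (cQ (N k))) b = Algebra.GrothendieckGroup.of c →
      ∃ c₂ : d₂.Φ.obj (op (E.functor.obj (cQ (N k)))),
        Frobenioids.divB d₂.Φ d₂.B d₂.divB (op (E.functor.obj (cQ (N k)))) (ΨB.hom.app (op (cQ (N k))) b) =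
          Algebra.GrothendieckGroup.of c₂) :
    ∃ (φ : G ≃ₜ* G₂) (ψ : φ₁.range ≃ₜ* φ₂.range) (ψbar : (Fbar ℚ_[p₁])ˣ ≃* (Fbar ℚ_[p₂])ˣ)
      (α : absoluteGaloisGroup (PadicFrd.RelGal.baseFld p₁ φ₁ hφ₁) ≃ₜ* absoluteGaloisGroup (PadicFrd.RelGal.baseFld p₂ φ₂ hφ₂))
      (ψn : (AlgebraicClosure (PadicFrd.RelGal.baseFld p₁ φ₁ hφ₁))ˣ ≃* (AlgebraicClosure (PadicFrd.RelGal.baseFld p₂ φ₂ hφ₂))ˣ),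
      φ₁.ker.map φ.toMulEquiv.toMonoidHom = φ₂.ker ∧
      (∀ g : G, (ψ ⟨φ₁ g, ⟨g, rfl⟩⟩ : GalFbar ℚ_[p₂]) = φ₂ (φ g)) ∧
      (∀ (σ : φ₁.range) (u : (Fbar ℚ_[p₁])ˣ),
        ψbar (Units.map ((σ : GalFbar ℚ_[p₁]) : Fbar ℚ_[p₁] →* Fbar ℚ_[p₁]) u) =
          Units.map (((ψ σ : φ₂.range) : GalFbar ℚ_[p₂]) : Fbar ℚ_[p₂] →* Fbar ℚ_[p₂]) (ψbar u)) ∧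
      (∀ τ : absoluteGaloisGroup (PadicFrd.RelGal.baseFld p₁ φ₁ hφ₁),
        ((PadicFrd.RelGal.galConjBase p₂ φ₂ hφ₂ (α τ) : ↥(PadicFrd.RelGal.baseFld p₂ φ₂ hφ₂).fixingSubgroup) :
            GalFbar ℚ_[p₂]) =
          (ψ ⟨(PadicFrd.RelGal.galConjBase p₁ φ₁ hφ₁ τ : ↥(PadicFrd.RelGal.baseFld p₁ φ₁ hφ₁).fixingSubgroup),
            MonoidHom.mem_range.mpr ((PadicFrd.RelGal.mem_fixingSubgroup_baseFld_iff p₁ φ₁ hφ₁ _).mp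
              (PadicFrd.RelGal.galConjBase p₁ φ₁ hφ₁ τ).2)⟩ : GalFbar ℚ_[p₂])) ∧
      (∀ y : (AlgebraicClosure (PadicFrd.RelGal.baseFld p₁ φ₁ hφ₁))ˣ,
        ((ψn y : (AlgebraicClosure (PadicFrd.RelGal.baseFld p₂ φ₂ hφ₂))ˣ) :
            AlgebraicClosure (PadicFrd.RelGal.baseFld p₂ φ₂ hφ₂)) =
          (PadicFrd.RelGal.closureEquiv p₂ φ₂ hφ₂).symm
            ((ψbar (Units.map ((PadicFrd.RelGal.closureEquiv p₁ φ₁ hφ₁ :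
              AlgebraicClosure (PadicFrd.RelGal.baseFld p₁ φ₁ hφ₁) ≃ₐ[PadicFrd.RelGal.baseFld p₁ φ₁ hφ₁] Fbar ℚ_[p₁]) :
                AlgebraicClosure (PadicFrd.RelGal.baseFld p₁ φ₁ hφ₁) →* Fbar ℚ_[p₁]) y) : (Fbar ℚ_[p₂])ˣ) :
              Fbar ℚ_[p₂])) ∧
      Prop121vii.IsAlphaEquivariant α ψn ∧ Prop121vii.PreservesAbsUnits ψn ∧ Prop121vii.PreservesUniformizers ψn := by
  haveI : CharZero (PadicFrd.RelGal.baseFld p₁ φ₁ hφ₁) :=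
    charZero_of_injective_algebraMap (algebraMap ℚ_[p₁] (PadicFrd.RelGal.baseFld p₁ φ₁ hφ₁)).injective
  haveI : CharZero (PadicFrd.RelGal.baseFld p₂ φ₂ hφ₂) :=
    charZero_of_injective_algebraMap (algebraMap ℚ_[p₂] (PadicFrd.RelGal.baseFld p₂ φ₂ hφ₂)).injective
  obtain ⟨φ, ψ, ψbar, hker, hψ, hσ, hint⟩ :=
    exists_pairIso_fbarUnits_integral hG hG₂ φ₁ hφ₁ φ₂ hφ₂ N hN d₁ d₂ hd₁ hd₂ hfs₁ hfs₂ E ΨB hNb hpos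
  obtain ⟨α, ψn, hα, hψn, heq⟩ := exists_isAlphaEquivariant_of_compatible φ₁ hφ₁ φ₂ hφ₂ ψ ψbar hσ
  obtain ⟨hu, ψ₀, ⟨hψ₀, hu₀, hπ₀⟩, halt⟩ := preservesAbsUnits_of_isAlphaEquivariant heq
  have hψn_eq : ψn = ψ₀ := by
    rcases halt with h | h
    · exact h
    · exfalso
      -- a uniformiser `π₁` of `K₁` and its image `π₂`, a uniformiser of `K₂`, under `ψ₀`
      obtain ⟨ϖ₁, hϖ₁⟩ := Valuation.exists_isUniformizer_of_isCyclic_of_nontrivial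
        (valuation (PadicFrd.RelGal.baseFld p₁ φ₁ hφ₁))
      let U₁ : (PadicFrd.RelGal.baseFld p₁ φ₁ hφ₁)ˣ := Units.mk0 _ hϖ₁.ne_zero
      obtain ⟨π₂, hπ₂, hψ₀U⟩ := hπ₀ U₁ hϖ₁
      -- `ψ̄♮ (π₁) = π₂⁻¹`
      let y : (AlgebraicClosure (PadicFrd.RelGal.baseFld p₁ φ₁ hφ₁))ˣ :=
        Units.map (algebraMap (PadicFrd.RelGal.baseFld p₁ φ₁ hφ₁) (AlgebraicClosure (PadicFrd.RelGal.baseFld p₁ φ₁ hφ₁)) :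
          PadicFrd.RelGal.baseFld p₁ φ₁ hφ₁ →* AlgebraicClosure (PadicFrd.RelGal.baseFld p₁ φ₁ hφ₁)) U₁
      have hy : ψn y = (Units.map (algebraMap (PadicFrd.RelGal.baseFld p₂ φ₂ hφ₂)
          (AlgebraicClosure (PadicFrd.RelGal.baseFld p₂ φ₂ hφ₂)) : _ →* _) π₂)⁻¹ := by
        rw [h y, hψ₀U]
      -- the element `V₁ = ι₁(π₁) = π₁ ∈ ℚ̄_{p₁}` is a `p₁`-adic integer
      let V₁ : (Fbar ℚ_[p₁])ˣ := Units.map ((PadicFrd.RelGal.closureEquiv p₁ φ₁ hφ₁ :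
        AlgebraicClosure (PadicFrd.RelGal.baseFld p₁ φ₁ hφ₁) ≃ₐ[PadicFrd.RelGal.baseFld p₁ φ₁ hφ₁] Fbar ℚ_[p₁]) :
          AlgebraicClosure (PadicFrd.RelGal.baseFld p₁ φ₁ hφ₁) →* Fbar ℚ_[p₁]) y
      have hV₁ : (V₁ : Fbar ℚ_[p₁]) = ((ϖ₁ : PadicFrd.RelGal.baseFld p₁ φ₁ hφ₁) : Fbar ℚ_[p₁]) := by
        change PadicFrd.RelGal.closureEquiv p₁ φ₁ hφ₁ (algebraMap (PadicFrd.RelGal.baseFld p₁ φ₁ hφ₁)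
          (AlgebraicClosure (PadicFrd.RelGal.baseFld p₁ φ₁ hφ₁)) ϖ₁) = _
        rw [AlgEquiv.commutes]
        rfl
      have hV₁int : ‖(show PadicAlgCl p₁ from (V₁ : Fbar ℚ_[p₁]))‖ ≤ 1 := by
        rw [hV₁]
        exact (hv₁ ϖ₁).mp hϖ₁.val_lt_one.le
      -- hence so is `ψ̄ V₁ = ι₂ (ψ̄♮ π₁) = π₂⁻¹`
      have h2 := hint V₁ hV₁int
      have hval : ((ψbar V₁ : (Fbar ℚ_[p₂])ˣ) : Fbar ℚ_[p₂]) =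
          (((π₂⁻¹ : (PadicFrd.RelGal.baseFld p₂ φ₂ hφ₂)ˣ) : PadicFrd.RelGal.baseFld p₂ φ₂ hφ₂) : Fbar ℚ_[p₂]) := by
        have h3 := hψn y
        rw [hy] at h3
        have h4 := congrArg (PadicFrd.RelGal.closureEquiv p₂ φ₂ hφ₂) h3
        rw [AlgEquiv.apply_symm_apply] at h4
        rw [← h4, Units.val_inv_eq_inv_val, Units.coe_map, MonoidHom.coe_coe, map_inv₀, AlgEquiv.commutes,
          Units.val_inv_eq_inv_val]
        rfl
      have h5 : valuation (PadicFrd.RelGal.baseFld p₂ φ₂ hφ₂) (((π₂⁻¹ : (PadicFrd.RelGal.baseFld p₂ φ₂ hφ₂)ˣ) :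
          PadicFrd.RelGal.baseFld p₂ φ₂ hφ₂)) ≤ 1 := by
        refine (hv₂ _).mpr ?_
        have h6 : ‖(show PadicAlgCl p₂ from ((ψbar V₁ : (Fbar ℚ_[p₂])ˣ) : Fbar ℚ_[p₂]))‖ ≤ 1 := h2
        rwa [hval] at h6
      rw [Units.val_inv_eq_inv_val, map_inv₀] at h5
      have h7 := hπ₂.val_lt_one
      have h8 : 0 < valuation (PadicFrd.RelGal.baseFld p₂ φ₂ hφ₂) (π₂ : PadicFrd.RelGal.baseFld p₂ φ₂ hφ₂) :=
        zero_lt_iff.mpr ((Valuation.ne_zero_iff _).mpr π₂.ne_zero)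
      have h9 := one_lt_inv_iff₀.mpr ⟨h8, h7⟩
      exact absurd h5 (not_le.mpr h9)
  refine ⟨φ, ψ, ψbar, α, ψn, hker, hψ, hσ, hα, hψn, heq, hu, ?_⟩
  rw [hψn_eq]
  exact hπ₀

end Chart

end BaseGaloisSystem

end Literature.AlgebraicGeometry.Frobenioids

end
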